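import Summits.AtomisticToContinuum.Crystallization.Theorems.OverbindingBudgetAffineRunCutSheetCrossing
import Summits.AtomisticToContinuum.Crystallization.Theorems.OverbindingBudgetAffineCompressedCutReach

/-!
# `OverbindingBudget` / crux `RobustDefectLimitWindows` (stmt-AtomisticToContinuum-31280) — «RunCut»: LEG COVER (the 3-D covering constant of both first shells)

Support file (lens-4 g89 head start for part 23C «LEGS»; memo `g89/memo/ATLAS-STAR-g89.md` §2 (P), order (2c), ρ₁ = 30).  Part 21
(`…RunCutSheetCover.best_of_six`) is the PLANAR covering statement (the hexagon of basal directions sees every in-plane direction at `≤ 30°`);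
the legs of part 23 descend through ALL of space toward the hub site and need the spatial analogue: ★ every direction of `ℝ³` is seen by a
FIRST-SHELL vector of the fcc pattern (cuboctahedron) AND of the hcp pattern (anticuboctahedron) at an angle `≤ 45°` — support-function form
`⟪w, u⟫ ≥ 0`, `⟪w, u⟫² ≥ (1/2)‖w‖²`, `‖u‖ = 1` — and the constant `1/√2` is attained (fcc: the coordinate axes; hcp: also `(−2,−2,1)/3`-type).
§1 integer model (`decide`): the twelve `(±3,±3,0)`-type vectors are points of `fccModelInt`; the `(3,3,0)`-type, the six basal `3(eᵢ − e_k)` and the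
three lower caps `−(4eₐ + e_b + e_c)` are points of `hcpModelInt`; all have `sqNormInt = 18` (unit after `/√18`); `⟪w, ·⟫` formulas.
§2 ★ `shellCover_fcc`: order the coordinates `|w a| ≥ |w b| ≥ |w c|`; the label `3(±eₐ ± e_b)` with the signs of `w a`, `w b` gives
`⟪w, u⟫ = (|w a| + |w b|)/√2` and `(|w a| + |w b|)² ≥ ‖w‖²` because `2|w a||w b| ≥ w c²`.
§3 ★ `shellCover_hcp`: the same label unless `w a ≤ 0 ∧ w b ≤ 0` (the anticuboctahedron lacks the three `(−3,−3,0)`-type points); then for `w c ≤ 0` the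
lower cap `−(4eₐ + e_b + e_c)/√18` gives `(4A + B + C)² ≥ 9(A² + B² + C²)` (`A ≥ B ≥ C ≥ 0` the absolute values), and for `w c > 0` either the basal
`3(e_c − eₐ)` (when `B² ≤ 2AC`) or that cap (when `2AC ≤ B²`, whence `2C ≤ B` and `(4A + B − C)² − 9(A² + B² + C²) ≥ 7A² + 4AB − 11B² ≥ 0`).
§4 frames: `shellCover_frame`, `shellCover_fcc_frame`, `shellCover_hcp_frame`, ★ `shellCover_chart` (`P ∈ {fcc, hcp}`) — through a linear isometry `Q` (pull back by
`LinearIsometry.toLinearIsometryEquiv`, as in `…SheetCover.best_of_six_frame`): `∃ u ∈ P, ‖u‖ = 1 ∧ ⟪W, Q u⟫ ≥ 0 ∧ ⟪W, Q u⟫² ≥ (1/2)‖W‖²`.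
§5 ONE chart `(P, Q, A, f)` at `m` (pointwise `AffFramed (10⁻⁴, 10⁻³, ·)` clauses, `P ∈ {fcc, hcp}`), `ν = nearestDist y m`: ★★ `space_step` — for ANY `X`
some first-shell `u ∈ P` gives `m′ = f u`, `s = y m′ − y m` with (i) `⟪X, s⟫ ≥ 0.706 ν‖X‖`, (ii) `‖s‖ ≤ 1.0011 ν`, (iii) the ONE-STEP LAW
`‖X − s‖² ≤ ‖X‖² − 1.412 ν‖X‖ + 1.0023 ν²` (the spatial twin of `…SheetCover.greedy_step`; iterated by the legs of part 23).
§6 leg arithmetic (pure reals, twin of `…SheetCover` §4): `leg_law_normalise` (`R′² ≤ G(R) = 1.0067(R² − 1.412R + 1.0023)` in units of the current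
site, per-bond scale ratio `≥ 0.9967`), `leg_envelope_step`, ★ `leg_envelope` — rungs `1.5, 2.02, 2.58, …, 10.14, 10.78`: a leg obeying the law while
`R > 3/2` reaches `R ≤ 3/2` within `15` steps from `R ≤ 10.78` (`14` from `10.14`, `3` from `3.17`).
Nearest in-tree prior art (other import cones, other constants): `…HullExactificationCascadeRobustBarlowTemplateStubExhaust.exhaust_cover_fcc/_hcp`
(`⟪v, p⟫ ≥ ‖v‖/2`, 60°, kissing patterns), `…OverbindingBudgetTwoShellCoverDirections.fcc_direction/hcp_direction` (cap `57/50` or shell `4/5`, unit `n`),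
the private `…PhononSlackCertificatesNearFieldConvexityStubChartCoverage.cover_fcc/_hcp`; here: FIRST shell only, the sharp `45°`, support-function
form over the two-shell patterns and frames of the RunCut charts, plus the chart-level step.
[this file: 0 definitions, 20 theorems; imports tree `…RunCutSheetCrossing` + `…CompressedCutReach` (the lower cap inequality is its `nine_sq_le_cap`,
cited — lane edition hand-2 g43, gate dedup); standard axioms]
-/

namespace Summit.AtomisticToContinuum.Crystallization.Theorems.OverbindingBudgetAffineRunCutLegCover

open scoped InnerProductSpace
open Literature.Geometry.DiscreteGeometry
open Summit.AtomisticToContinuum.Crystallization.Theorems.OverbindingBudgetAffineRunCutSheetCover (inner_intVec_right hexDir_model)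
open Summit.AtomisticToContinuum.Crystallization.Theorems.OverbindingBudgetAffineCompressedCutEstablish (nearestDist_pos_of_frame)

local notation "E3" => EuclideanSpace ℝ (Fin 3)

/-! ## §1 Integer model: the labels used by the covering arguments -/

/-- The four `(±3, ±3, 0)`-type vectors on the coordinate pair `a ≠ b` are points of `fccModelInt`. [this file · kind: computation] -/
theorem fccDir_model : ∀ a b : Fin 3, a ≠ b →
    (3 • (Pi.single a 1 + Pi.single b 1) : Fin 3 → ℤ) ∈ fccModelInt ∧ (3 • (Pi.single a 1 - Pi.single b 1) : Fin 3 → ℤ) ∈ fccModelInt ∧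
    (3 • (-Pi.single a 1 + Pi.single b 1) : Fin 3 → ℤ) ∈ fccModelInt ∧ (3 • (-Pi.single a 1 - Pi.single b 1) : Fin 3 → ℤ) ∈ fccModelInt := by
  decide

/-- The `(3,3,0)`-type vector on the pair `a ≠ b` (an upper cap) is a point of `hcpModelInt`; the basal `3(eᵢ − e_k)` are
`…SheetCover.hexDir_model`. [this file · kind: computation] -/
theorem hcpUp_model : ∀ a b : Fin 3, a ≠ b → (3 • (Pi.single a 1 + Pi.single b 1) : Fin 3 → ℤ) ∈ hcpModelInt := by
  decide

/-- The lower cap `−(4eₐ + e_b + e_c)` (`a, b, c` distinct) is a point of `hcpModelInt`. [this file · kind: computation] -/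
theorem hcpLow_model : ∀ a b c : Fin 3, a ≠ b → c ≠ a → c ≠ b →
    (-(Pi.single a 4 + Pi.single b 1 + Pi.single c 1) : Fin 3 → ℤ) ∈ hcpModelInt := by
  decide

/-- All these labels have squared norm `18`. [this file · kind: computation] -/
theorem dir_sqNorm : ∀ a b c : Fin 3, a ≠ b → c ≠ a → c ≠ b →
    sqNormInt (3 • (Pi.single a 1 + Pi.single b 1) : Fin 3 → ℤ) = 18 ∧ sqNormInt (3 • (Pi.single a 1 - Pi.single b 1) : Fin 3 → ℤ) = 18 ∧
    sqNormInt (3 • (-Pi.single a 1 + Pi.single b 1) : Fin 3 → ℤ) = 18 ∧ sqNormInt (3 • (-Pi.single a 1 - Pi.single b 1) : Fin 3 → ℤ) = 18 ∧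
    sqNormInt (-(Pi.single a 4 + Pi.single b 1 + Pi.single c 1) : Fin 3 → ℤ) = 18 := by
  decide

/-- A model point with `sqNormInt = 18` is a unit vector after scaling by `1/√18`. [this file · kind: glue] -/
theorem norm_eq_one_of_sqNorm {v : Fin 3 → ℤ} (hv : sqNormInt v = 18) : ‖((Real.sqrt 18)⁻¹ • intVec v : E3)‖ = 1 := by
  have h := norm_sq_intVec_div v
  have h1 : ‖((Real.sqrt 18)⁻¹ • intVec v : E3)‖ ^ 2 = 1 := by rw [h, hv]; norm_num
  rw [← Real.sqrt_sq (norm_nonneg ((Real.sqrt 18)⁻¹ • intVec v : E3)), h1, Real.sqrt_one]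

/-- `⟪w, ·⟫` against the labels: `3(±w a ± w b)` and `−(4 w a + w b + w c)`. [this file · kind: glue] -/
theorem inner_dir (w : E3) : ∀ a b c : Fin 3,
    ⟪w, intVec (3 • (Pi.single a 1 + Pi.single b 1))⟫_ℝ = 3 * (w a + w b) ∧ ⟪w, intVec (3 • (Pi.single a 1 - Pi.single b 1))⟫_ℝ = 3 * (w a - w b) ∧
    ⟪w, intVec (3 • (-Pi.single a 1 + Pi.single b 1))⟫_ℝ = 3 * (-w a + w b) ∧
    ⟪w, intVec (3 • (-Pi.single a 1 - Pi.single b 1))⟫_ℝ = 3 * (-w a - w b) ∧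
    ⟪w, intVec (-(Pi.single a 4 + Pi.single b 1 + Pi.single c 1))⟫_ℝ = -(4 * w a + w b + w c) := by
  intro a b c
  refine ⟨?_, ?_, ?_, ?_, ?_⟩ <;> rw [inner_intVec_right] <;> fin_cases a <;> fin_cases b <;> (try fin_cases c) <;> simp <;> ring

/-- The scaled witness: for a label `v` with `sqNormInt v = 18` and `⟪w, intVec v⟫ = 3 s` with `0 ≤ s` and `‖w‖² ≤ s²`, the point
`u = v/√18` has `‖u‖ = 1`, `⟪w, u⟫ ≥ 0`, `⟪w, u⟫² ≥ (1/2)‖w‖²` (`(3/√18)² = 1/2`). [this file · kind: glue] -/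
theorem shellCover_witness (w : E3) {v : Fin 3 → ℤ} (hv : sqNormInt v = 18) {s : ℝ} (hs : ⟪w, intVec v⟫_ℝ = 3 * s) (hs0 : 0 ≤ s)
    (hws : ‖w‖ ^ 2 ≤ s ^ 2) :
    ‖((Real.sqrt 18)⁻¹ • intVec v : E3)‖ = 1 ∧ 0 ≤ ⟪w, ((Real.sqrt 18)⁻¹ • intVec v : E3)⟫_ℝ ∧
      1 / 2 * ‖w‖ ^ 2 ≤ ⟪w, ((Real.sqrt 18)⁻¹ • intVec v : E3)⟫_ℝ ^ 2 := by
  have h18 : (3 * (Real.sqrt 18)⁻¹) ^ 2 = (1 / 2 : ℝ) := by rw [mul_pow, inv_pow, Real.sq_sqrt (by norm_num)]; norm_num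
  have h18' : (0 : ℝ) ≤ 3 * (Real.sqrt 18)⁻¹ := by positivity
  have hi : ⟪w, ((Real.sqrt 18)⁻¹ • intVec v : E3)⟫_ℝ = 3 * (Real.sqrt 18)⁻¹ * s := by rw [real_inner_smul_right, hs]; ring
  refine ⟨norm_eq_one_of_sqNorm hv, by rw [hi]; exact mul_nonneg h18' hs0, ?_⟩
  rw [hi, mul_pow, h18]; linarith

/-! ## §2 The cuboctahedron covers space at 45° -/

/-- Generic ordered case for fcc: `|w c| ≤ |w b| ≤ |w a|` (`a, b, c` distinct). [this file · kind: proof] -/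
theorem shellCover_fcc_key (w : E3) {a b c : Fin 3} (hab : a ≠ b) (hca : c ≠ a) (hcb : c ≠ b)
    (hn : ‖w‖ ^ 2 = w a ^ 2 + w b ^ 2 + w c ^ 2) (hba : |w b| ≤ |w a|) (hcb' : |w c| ≤ |w b|) :
    ∃ u ∈ fccTwoShellPattern, ‖u‖ = 1 ∧ 0 ≤ ⟪w, u⟫_ℝ ∧ 1 / 2 * ‖w‖ ^ 2 ≤ ⟪w, u⟫_ℝ ^ 2 := by
  obtain ⟨mpp, mpm, mmp, mmm⟩ := fccDir_model a b hab
  obtain ⟨npp, npm, nmp, nmm, -⟩ := dir_sqNorm a b c hab hca hcb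
  obtain ⟨ipp, ipm, imp, imm, -⟩ := inner_dir w a b c
  -- the key inequality `‖w‖² ≤ (|w a| + |w b|)²` from `w c² ≤ |w a||w b| ≤ 2|w a||w b|`
  have hkey : ‖w‖ ^ 2 ≤ (|w a| + |w b|) ^ 2 := by
    have h1 : |w c| * |w c| ≤ |w a| * |w b| := by
      have := mul_le_mul hcb' (hcb'.trans hba) (abs_nonneg _) (abs_nonneg _); linarith [mul_comm (|w b|) (|w a|)]
    rw [hn]; nlinarith [abs_mul_abs_self (w a), abs_mul_abs_self (w b), abs_mul_abs_self (w c), abs_nonneg (w a), abs_nonneg (w b)]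
  have mem : ∀ v : Fin 3 → ℤ, v ∈ fccModelInt → ((Real.sqrt 18)⁻¹ • intVec v : E3) ∈ fccTwoShellPattern := by
    intro v hv; rw [fccTwoShellPattern_eq_image]; simp only [Nat.cast_ofNat]; exact Finset.mem_image_of_mem _ hv
  rcases le_total 0 (w a) with ha | ha <;> rcases le_total 0 (w b) with hb | hb
  · refine ⟨_, mem _ mpp, shellCover_witness w npp ipp (by positivity) ?_⟩
    rwa [abs_of_nonneg ha, abs_of_nonneg hb] at hkey
  · refine ⟨_, mem _ mpm, shellCover_witness w npm ipm (by linarith) ?_⟩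
    rw [abs_of_nonneg ha, abs_of_nonpos hb] at hkey; simpa [sub_eq_add_neg] using hkey
  · refine ⟨_, mem _ mmp, shellCover_witness w nmp imp (by linarith) ?_⟩
    rw [abs_of_nonpos ha, abs_of_nonneg hb] at hkey; simpa using hkey
  · refine ⟨_, mem _ mmm, shellCover_witness w nmm imm (by linarith) ?_⟩
    rw [abs_of_nonpos ha, abs_of_nonpos hb] at hkey; simpa [sub_eq_add_neg] using hkey

/-- ★ **THE CUBOCTAHEDRON COVERS SPACE AT 45°.**  For every `w` some FIRST-SHELL point `u` of `fccTwoShellPattern` (`‖u‖ = 1`) has `⟪w, u⟫ ≥ 0` and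
`⟪w, u⟫² ≥ (1/2)‖w‖²`; the constant is sharp (`w` a coordinate axis). [this file · kind: proof] -/
theorem shellCover_fcc (w : E3) : ∃ u ∈ fccTwoShellPattern, ‖u‖ = 1 ∧ 0 ≤ ⟪w, u⟫_ℝ ∧ 1 / 2 * ‖w‖ ^ 2 ≤ ⟪w, u⟫_ℝ ^ 2 := by
  have hn : ‖w‖ ^ 2 = w 0 ^ 2 + w 1 ^ 2 + w 2 ^ 2 := by
    rw [EuclideanSpace.norm_sq_eq, Fin.sum_univ_three]; simp [Real.norm_eq_abs, sq_abs]
  have n01 : (0 : Fin 3) ≠ 1 := by decide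
  have n02 : (0 : Fin 3) ≠ 2 := by decide
  have n12 : (1 : Fin 3) ≠ 2 := by decide
  rcases le_total |w 1| |w 0| with h01 | h01 <;> rcases le_total |w 2| |w 1| with h12 | h12 <;>
    rcases le_total |w 2| |w 0| with h02 | h02
  · exact shellCover_fcc_key w n01 n02.symm n12.symm hn h01 h12
  · exact shellCover_fcc_key w n01 n02.symm n12.symm hn h01 h12
  · exact shellCover_fcc_key w n02 n01.symm n12 (by rw [hn]; ring) h02 h12
  · exact shellCover_fcc_key w n02.symm n12 n01.symm (by rw [hn]; ring) h02 h01
  · exact shellCover_fcc_key w n01.symm n12.symm n02.symm (by rw [hn]; ring) h01 h02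
  · exact shellCover_fcc_key w n12 n01 n02 (by rw [hn]; ring) h12 h02
  · exact shellCover_fcc_key w n01.symm n12.symm n02.symm (by rw [hn]; ring) h01 h02
  · exact shellCover_fcc_key w n12.symm n02 n01 (by rw [hn]; ring) h12 h01

/-! ## §3 The anticuboctahedron covers space at 45° -/

/-- Cap inequality, mixed sign case: `0 ≤ C`, `2C ≤ B ≤ A` ⇒ `9(A² + B² + C²) ≤ (4A + B − C)²`
(`(4A + B − C)² − 9(A² + B² + C²) ≥ 7A² + 4AB − 11B² ≥ 0`). [this file · kind: glue] -/
theorem cap_ineq_mixed {A B C : ℝ} (hC : 0 ≤ C) (h2C : 2 * C ≤ B) (hBA : B ≤ A) :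
    9 * (A ^ 2 + B ^ 2 + C ^ 2) ≤ (4 * A + B - C) ^ 2 := by
  have hB : 0 ≤ B := by linarith
  have q1 := mul_nonneg (by linarith : 0 ≤ B / 2 - C) (by linarith : 0 ≤ B / 2 + C)
  have q2 := mul_nonneg (hB.trans hBA) (by linarith : 0 ≤ B / 2 - C)
  have q3 := mul_nonneg hB (by linarith : 0 ≤ B / 2 - C)
  have q4 := mul_nonneg (by linarith : 0 ≤ A - B) (by linarith : 0 ≤ A + B)
  have q5 := mul_nonneg hB (by linarith : 0 ≤ A - B)
  nlinarith [q1, q2, q3, q4, q5]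
set_option maxHeartbeats 400000 in
/-- Generic ordered case for hcp: `|w c| ≤ |w b| ≤ |w a|` (`a, b, c` distinct); see the file header for the case tree. [this file · kind: proof] -/
theorem shellCover_hcp_key (w : E3) {a b c : Fin 3} (hab : a ≠ b) (hca : c ≠ a) (hcb : c ≠ b)
    (hn : ‖w‖ ^ 2 = w a ^ 2 + w b ^ 2 + w c ^ 2) (hba : |w b| ≤ |w a|) (hcb' : |w c| ≤ |w b|) :
    ∃ u ∈ hcpTwoShellPattern, ‖u‖ = 1 ∧ 0 ≤ ⟪w, u⟫_ℝ ∧ 1 / 2 * ‖w‖ ^ 2 ≤ ⟪w, u⟫_ℝ ^ 2 := by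
  have mem : ∀ v : Fin 3 → ℤ, v ∈ hcpModelInt → ((Real.sqrt 18)⁻¹ • intVec v : E3) ∈ hcpTwoShellPattern := by
    intro v hv; rw [hcpTwoShellPattern_eq_image]; simp only [Nat.cast_ofNat]; exact Finset.mem_image_of_mem _ hv
  have mpp := hcpUp_model a b hab
  have mcap := hcpLow_model a b c hab hca hcb
  obtain ⟨npp, npm, -, -, ncap⟩ := dir_sqNorm a b c hab hca hcb
  obtain ⟨ipp, ipm, -, -, icap⟩ := inner_dir w a b c
  have haa := abs_mul_abs_self (w a); have hbb := abs_mul_abs_self (w b); have hcc := abs_mul_abs_self (w c)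
  have hkey : ‖w‖ ^ 2 ≤ (|w a| + |w b|) ^ 2 := by
    have h1 : |w c| * |w c| ≤ |w a| * |w b| := by
      have := mul_le_mul hcb' (hcb'.trans hba) (abs_nonneg _) (abs_nonneg _); linarith [mul_comm (|w b|) (|w a|)]
    rw [hn]; nlinarith [abs_nonneg (w a), abs_nonneg (w b)]
  rcases le_total 0 (w a) with ha | ha <;> rcases le_total 0 (w b) with hb | hb
  · -- (+,+): the upper cap `3(eₐ + e_b)`
    refine ⟨_, mem _ mpp, shellCover_witness w npp ipp (by positivity) ?_⟩
    rwa [abs_of_nonneg ha, abs_of_nonneg hb] at hkey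
  · -- (+,−): basal `3(eₐ − e_b)`
    refine ⟨_, mem _ (hexDir_model a b hab).1, shellCover_witness w npm ipm (by linarith) ?_⟩
    rw [abs_of_nonneg ha, abs_of_nonpos hb] at hkey; simpa [sub_eq_add_neg] using hkey
  · -- (−,+): basal `3(e_b − eₐ)`
    obtain ⟨-, nba, -⟩ := dir_sqNorm b a c hab.symm hcb hca
    obtain ⟨-, iba, -⟩ := inner_dir w b a c
    refine ⟨_, mem _ (hexDir_model b a hab.symm).1, shellCover_witness w nba iba (by linarith) ?_⟩
    rw [abs_of_nonpos ha, abs_of_nonneg hb] at hkey; simpa [sub_eq_add_neg, add_comm] using hkey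
  · -- (−,−): absolute values `A ≥ B ≥ C`
    have hA : |w a| = -w a := abs_of_nonpos ha
    have hB : |w b| = -w b := abs_of_nonpos hb
    have hBA : -w b ≤ -w a := by rw [← hA, ← hB]; exact hba
    rcases le_total (w c) 0 with hc | hc
    · -- `w c ≤ 0`: the lower cap `−(4eₐ + e_b + e_c)`, `(4A + B + C)² ≥ 16A² + 9B² + 9C² ≥ 9‖w‖²`
      have hC : |w c| = -w c := abs_of_nonpos hc
      have hCB : -w c ≤ -w b := by rw [← hB, ← hC]; exact hcb'
      refine ⟨_, mem _ mcap, shellCover_witness w ncap (s := -(4 * w a + w b + w c) / 3) (by rw [icap]; ring) (by linarith) ?_⟩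
      have key := OverbindingBudgetAffineCompressedCutReach.nine_sq_le_cap (by linarith : 0 ≤ -w c) hCB hBA
      rw [hn]; nlinarith [key]
    · -- `0 ≤ w c` (`C ≤ B`): basal `3(e_c − eₐ)` when `B² ≤ 2AC`, else the lower cap
      have hC : |w c| = w c := abs_of_nonneg hc
      have hCB : w c ≤ -w b := by rw [← hB, ← hC]; exact hcb'
      by_cases h2 : w b ^ 2 ≤ 2 * (-w a) * w c
      · obtain ⟨-, nca, -⟩ := dir_sqNorm c a b hca hcb.symm hab.symm
        obtain ⟨-, ica, -⟩ := inner_dir w c a b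
        refine ⟨_, mem _ (hexDir_model c a hca).1, shellCover_witness w nca ica (by linarith) ?_⟩
        rw [hn]; nlinarith [h2]
      · have h2' : 2 * (-w a) * w c ≤ w b ^ 2 := (not_le.1 h2).le
        -- `2AC ≤ B²` and `B ≤ A` force `2C ≤ B`
        have h2C : 2 * w c ≤ -w b := by
          rcases eq_or_lt_of_le (show 0 ≤ -w b by linarith) with hB0 | hB0
          · linarith
          · by_contra h
            have h' : -w b < 2 * w c := not_le.1 h
            have t1 : -w b * -w b < -w b * (2 * w c) := mul_lt_mul_of_pos_left h' hB0
            have t2 : 2 * w c * -w b ≤ 2 * w c * -w a := mul_le_mul_of_nonneg_left hBA (by linarith)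
            nlinarith [t1, t2]
        refine ⟨_, mem _ mcap, shellCover_witness w ncap (s := -(4 * w a + w b + w c) / 3) (by rw [icap]; ring) (by linarith) ?_⟩
        have key := cap_ineq_mixed hc h2C hBA
        rw [hn]; nlinarith [key]

/-- ★ **THE ANTICUBOCTAHEDRON COVERS SPACE AT 45°.**  For every `w` some FIRST-SHELL point `u` of `hcpTwoShellPattern` (`‖u‖ = 1`) has `⟪w, u⟫ ≥ 0`
and `⟪w, u⟫² ≥ (1/2)‖w‖²`; sharp at the coordinate axes and at the `(−2,−2,1)`-type directions. [this file · kind: proof] -/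
theorem shellCover_hcp (w : E3) : ∃ u ∈ hcpTwoShellPattern, ‖u‖ = 1 ∧ 0 ≤ ⟪w, u⟫_ℝ ∧ 1 / 2 * ‖w‖ ^ 2 ≤ ⟪w, u⟫_ℝ ^ 2 := by
  have hn : ‖w‖ ^ 2 = w 0 ^ 2 + w 1 ^ 2 + w 2 ^ 2 := by
    rw [EuclideanSpace.norm_sq_eq, Fin.sum_univ_three]; simp [Real.norm_eq_abs, sq_abs]
  have n01 : (0 : Fin 3) ≠ 1 := by decide
  have n02 : (0 : Fin 3) ≠ 2 := by decide
  have n12 : (1 : Fin 3) ≠ 2 := by decide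
  rcases le_total |w 1| |w 0| with h01 | h01 <;> rcases le_total |w 2| |w 1| with h12 | h12 <;>
    rcases le_total |w 2| |w 0| with h02 | h02
  · exact shellCover_hcp_key w n01 n02.symm n12.symm hn h01 h12
  · exact shellCover_hcp_key w n01 n02.symm n12.symm hn h01 h12
  · exact shellCover_hcp_key w n02 n01.symm n12 (by rw [hn]; ring) h02 h12
  · exact shellCover_hcp_key w n02.symm n12 n01.symm (by rw [hn]; ring) h02 h01
  · exact shellCover_hcp_key w n01.symm n12.symm n02.symm (by rw [hn]; ring) h01 h02
  · exact shellCover_hcp_key w n12 n01 n02 (by rw [hn]; ring) h12 h02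
  · exact shellCover_hcp_key w n01.symm n12.symm n02.symm (by rw [hn]; ring) h01 h02
  · exact shellCover_hcp_key w n12.symm n02 n01 (by rw [hn]; ring) h12 h01

/-! ## §4 Through a frame -/

/-- Pull-back of a support-function covering statement through a linear isometry of `ℝ³` (onto: equal finite dimensions). [this file · kind: glue] -/
theorem shellCover_frame {P : Finset E3} (hP : ∀ w : E3, ∃ u ∈ P, ‖u‖ = 1 ∧ 0 ≤ ⟪w, u⟫_ℝ ∧ 1 / 2 * ‖w‖ ^ 2 ≤ ⟪w, u⟫_ℝ ^ 2)
    (Q : E3 →ₗᵢ[ℝ] E3) (W : E3) : ∃ u ∈ P, ‖u‖ = 1 ∧ 0 ≤ ⟪W, Q u⟫_ℝ ∧ 1 / 2 * ‖W‖ ^ 2 ≤ ⟪W, Q u⟫_ℝ ^ 2 := by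
  set Qe : E3 ≃ₗᵢ[ℝ] E3 := Q.toLinearIsometryEquiv rfl with hQedef
  have hQe : ∀ x : E3, Qe x = Q x := fun x => rfl
  set w : E3 := Qe.symm W with hwdef
  have hQw : Q w = W := by rw [← hQe, hwdef, Qe.apply_symm_apply]
  obtain ⟨u, hu, hu1, h0, h2⟩ := hP w
  have hi : ⟪W, Q u⟫_ℝ = ⟪w, u⟫_ℝ := by rw [← hQw, Q.inner_map_map]
  have hnw : ‖W‖ = ‖w‖ := by rw [← hQw, Q.norm_map]
  exact ⟨u, hu, hu1, by rw [hi]; exact h0, by rw [hi, hnw]; exact h2⟩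

/-- ★ `shellCover_fcc` through a frame. [this file · kind: proof] -/
theorem shellCover_fcc_frame (Q : E3 →ₗᵢ[ℝ] E3) (W : E3) :
    ∃ u ∈ fccTwoShellPattern, ‖u‖ = 1 ∧ 0 ≤ ⟪W, Q u⟫_ℝ ∧ 1 / 2 * ‖W‖ ^ 2 ≤ ⟪W, Q u⟫_ℝ ^ 2 :=
  shellCover_frame shellCover_fcc Q W

/-- ★ `shellCover_hcp` through a frame. [this file · kind: proof] -/
theorem shellCover_hcp_frame (Q : E3 →ₗᵢ[ℝ] E3) (W : E3) :
    ∃ u ∈ hcpTwoShellPattern, ‖u‖ = 1 ∧ 0 ≤ ⟪W, Q u⟫_ℝ ∧ 1 / 2 * ‖W‖ ^ 2 ≤ ⟪W, Q u⟫_ℝ ^ 2 :=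
  shellCover_frame shellCover_hcp Q W

/-- ★ **EITHER PATTERN.**  The form the legs consume: a chart pattern `P ∈ {fcc, hcp}` and a frame `Q`. [this file · kind: proof] -/
theorem shellCover_chart {P : Finset E3} (hP : P = fccTwoShellPattern ∨ P = hcpTwoShellPattern) (Q : E3 →ₗᵢ[ℝ] E3) (W : E3) :
    ∃ u ∈ P, ‖u‖ = 1 ∧ 0 ≤ ⟪W, Q u⟫_ℝ ∧ 1 / 2 * ‖W‖ ^ 2 ≤ ⟪W, Q u⟫_ℝ ^ 2 := by
  rcases hP with rfl | rfl; exacts [shellCover_fcc_frame Q W, shellCover_hcp_frame Q W]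

/-! ## §5 One chart: the SPATIAL GREEDY STEP toward a target -/

section Chart

variable {N : ℕ} {y : Fin N → E3} (hy : Function.Injective y) {m : Fin N} {P : Finset E3}
  (hP : P = fccTwoShellPattern ∨ P = hcpTwoShellPattern)
  {Q : E3 →ₗᵢ[ℝ] E3} {A : E3 →ₗ[ℝ] E3} {f : E3 → E3}
  (hA : ∀ v ∈ P, ‖A v - Q v‖ ≤ 1 / 1000)
  (hf : ∀ v ∈ P, f v ∈ Set.range y ∧ dist (f v) (y m + nearestDist y m • A v) ≤ 1 / 10 ^ 4 * nearestDist y m)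
  (hinj : Set.InjOn f ↑P)

include hy hP hA hf hinj

/-- ★★ **SPATIAL GREEDY STEP (one bond of a leg).**  One chart `(P, Q, A, f)` at `m` (pattern `P ∈ {fcc, hcp}`, pointwise `AffFramed (10⁻⁴, 10⁻³, ·)`
clauses) and ANY vector `X` (target minus position): some first-shell `u ∈ P` (`‖u‖ = 1`) leads to a site `m′ = f u`, `s = y m′ − y m`, with
(i) `⟪X, s⟫ ≥ (706/1000) ν_m ‖X‖` (`shellCover_chart`: `⟪X, Q u⟫ ≥ ‖X‖/√2 ≥ 0.7071‖X‖`, frame `10⁻³`, registration `10⁻⁴`), (ii) `‖s‖ ≤ 1.0011 ν_m`,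
(iii) the ONE-STEP LAW `‖X − s‖² ≤ ‖X‖² − (1412/1000) ν_m ‖X‖ + (10023/10000) ν_m²` — i.e. the distance to the target drops from `d` to at most
`√((d − 0.706ν)² + 0.504ν²)`; the legs of part 23 iterate it down to `d ≤ 3/2 ν` (memo ATLAS-STAR-g89 §2 (P): `N(10) = 15`, `N(13) = 19`).
[this file · kind: proof] -/
theorem space_step (X : E3) : ∃ u ∈ P, ‖u‖ = 1 ∧ ∀ m' : Fin N, f u = y m' →
      706 / 1000 * nearestDist y m * ‖X‖ ≤ ⟪X, y m' - y m⟫_ℝ ∧ ‖y m' - y m‖ ≤ 10011 / 10000 * nearestDist y m ∧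
      ‖X - (y m' - y m)‖ ^ 2 ≤ ‖X‖ ^ 2 - 1412 / 1000 * nearestDist y m * ‖X‖ + 10023 / 10000 * nearestDist y m ^ 2 := by
  set ν := nearestDist y m with hνdef
  have hν : 0 < ν := nearestDist_pos_of_frame hy hP (fun v hv => (hf v hv).1) hinj
  obtain ⟨u, hu, hu1, hpos, hsq⟩ := shellCover_chart hP Q X
  -- `⟪X, Q u⟫ ≥ 0.70710 ‖X‖` from `⟪X, Q u⟫² ≥ ‖X‖²/2`
  have hQu : 70710 / 100000 * ‖X‖ ≤ ⟪X, Q u⟫_ℝ := by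
    have hsq' : (70710 / 100000 * ‖X‖) ^ 2 ≤ ⟪X, Q u⟫_ℝ ^ 2 := by nlinarith [hsq, sq_nonneg ‖X‖]
    exact (pow_le_pow_iff_left₀ (by positivity) hpos two_ne_zero).1 hsq'
  refine ⟨u, hu, hu1, fun m' hm' => ?_⟩
  set s : E3 := y m' - y m with hsdef
  -- registration and frame at `u`: `‖s − ν A u‖ ≤ 10⁻⁴ ν`, `‖A u − Q u‖ ≤ 10⁻³`, `‖u‖ = 1`, `‖s‖ ≤ 1.0011 ν`
  have K1 : ‖s - ν • A u‖ ≤ 1 / 10 ^ 4 * ν := by have := (hf u hu).2; rwa [hm', dist_eq_norm, ← sub_sub] at this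
  have hAuQ : ‖A u - Q u‖ ≤ 1 / 1000 := hA u hu
  have hs : ‖s‖ ≤ 10011 / 10000 * ν := by
    have hAu : ‖A u‖ ≤ 1001 / 1000 := by
      have h := (abs_norm_sub_norm_le (A u) (Q u)).trans hAuQ
      rw [Q.norm_map, hu1, abs_le] at h
      linarith [h.2]
    have h1 : ‖s‖ ≤ ‖s - ν • A u‖ + ‖ν • A u‖ := by have := norm_add_le (s - ν • A u) (ν • A u); rwa [sub_add_cancel] at this
    rw [norm_smul, Real.norm_of_nonneg hν.le] at h1
    nlinarith [hAu, hν.le, K1]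
  -- (i) the progress inequality
  have hXs : 706 / 1000 * ν * ‖X‖ ≤ ⟪X, s⟫_ℝ := by
    have e : ⟪X, s⟫_ℝ = ⟪X, s - ν • A u⟫_ℝ + ν * (⟪X, Q u⟫_ℝ + ⟪X, A u - Q u⟫_ℝ) := by
      rw [inner_sub_right X s, real_inner_smul_right, inner_sub_right X (A u)]; ring
    have t1 : |⟪X, s - ν • A u⟫_ℝ| ≤ ‖X‖ * (1 / 10 ^ 4 * ν) := (abs_real_inner_le_norm _ _).trans (mul_le_mul_of_nonneg_left K1 (norm_nonneg _))
    have t2 : |⟪X, A u - Q u⟫_ℝ| ≤ ‖X‖ * (1 / 1000) := (abs_real_inner_le_norm _ _).trans (mul_le_mul_of_nonneg_left hAuQ (norm_nonneg _))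
    rw [abs_le] at t1 t2
    rw [e]; linarith [t1.1, mul_le_mul_of_nonneg_left hQu hν.le, mul_le_mul_of_nonneg_left t2.1 hν.le]
  refine ⟨hXs, hs, ?_⟩
  -- (iii) `‖X − s‖² = ‖X‖² − 2⟪X, s⟫ + ‖s‖²`
  have e2 : ‖X - s‖ ^ 2 = ‖X‖ ^ 2 - 2 * ⟪X, s⟫_ℝ + ‖s‖ ^ 2 := norm_sub_sq_real X s
  have hs2 : ‖s‖ ^ 2 ≤ (10011 / 10000 * ν) ^ 2 := pow_le_pow_left₀ (norm_nonneg _) hs 2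
  rw [e2]; nlinarith [hXs, hs2, hν.le]

end Chart

/-! ## §6 Leg arithmetic (pure reals): normalised law and the termination envelope -/

/-- **Normalised leg law.**  In units of the CURRENT site (`R = d/ν`, `R′ = d′/ν′`, per-bond scale ratio `ν′ ≥ (9967/10⁴) ν` — tree
`…CompressedCutScale.affFramed_scale_transfer_record`) the one-step law `d′² ≤ d² − 1.412 ν d + 1.0023 ν²` reads `R′² ≤ G(R)`,
`G(R) = (10067/10⁴)(R² − 1.412 R + 1.0023)` (`(10⁴/9967)² ≤ 1.0067`; the bracket is `(R − 0.706)² + 0.5039 > 0`). [this file · kind: glue] -/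
theorem leg_law_normalise {d d' ν ν' : ℝ} (hν : 0 < ν) (hν' : 9967 / 10000 * ν ≤ ν')
    (hlaw : d' ^ 2 ≤ d ^ 2 - 1412 / 1000 * ν * d + 10023 / 10000 * ν ^ 2) :
    (d' / ν') ^ 2 ≤ 10067 / 10000 * ((d / ν) ^ 2 - 1412 / 1000 * (d / ν) + 10023 / 10000) := by
  have hν'0 : 0 < ν' := by linarith
  set R := d / ν with hR
  have hd : d = R * ν := by rw [hR, div_mul_cancel₀ _ hν.ne']
  have hB : 0 ≤ R ^ 2 - 1412 / 1000 * R + 10023 / 10000 := by nlinarith [sq_nonneg (R - 706 / 1000)]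
  have h1 : d' ^ 2 ≤ ν ^ 2 * (R ^ 2 - 1412 / 1000 * R + 10023 / 10000) := by rw [hd] at hlaw; nlinarith [hlaw]
  have h2 : ν ^ 2 ≤ 10067 / 10000 * ν' ^ 2 := by nlinarith [hν', hν.le]
  rw [div_pow, div_le_iff₀ (by positivity)]
  nlinarith [h1, mul_le_mul_of_nonneg_right h2 hB]

/-- **Envelope step** (`G` is increasing on `R ≥ 0.706`): if `R ≤ b`, the law holds above the stop threshold `3/2`, and `G(b) ≤ c²` (`c ≥ 0`),
then `R ≤ 3/2` or `R′ ≤ c`. [this file · kind: glue] -/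
theorem leg_envelope_step {R R' b c : ℝ} (hR' : 0 ≤ R')
    (hG : 3 / 2 < R → R' ^ 2 ≤ 10067 / 10000 * (R ^ 2 - 1412 / 1000 * R + 10023 / 10000)) (hRb : R ≤ b) (hc : 0 ≤ c)
    (hbc : 10067 / 10000 * (b ^ 2 - 1412 / 1000 * b + 10023 / 10000) ≤ c ^ 2) : R ≤ 3 / 2 ∨ R' ≤ c := by
  rcases le_or_gt R (3 / 2) with h | h
  · exact Or.inl h
  · right
    have H : 0 ≤ (b - R) * (b + R - 1412 / 1000) := mul_nonneg (by linarith) (by linarith)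
    have h2 : R' ^ 2 ≤ c ^ 2 := by nlinarith [hG h, H, hbc]
    exact (pow_le_pow_iff_left₀ hR' hc two_ne_zero).1 h2

/-- ★ **THE LEG ENVELOPE (a leg terminates).**  `R` nonnegative; the normalised law is required only WHILE THE LEG RUNS (times `t₀ + s`, `s < T`,
no earlier time at the stop threshold `3/2`).  Rungs `τ = (1.5, 2.02, 2.58, 3.17, 3.78, 4.40, 5.03, 5.66, 6.30, 6.94, 7.58, 8.22, 8.86, 9.50, 10.14,
10.78)` with `G(τ_k) ≤ τ_{k−1}²` (exact decimals, `k = 1` the tight one: `2.2454 ≤ 2.25`): from `R t₀ ≤ 10.78` the leg stops (`R ≤ 3/2`) within `15`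
steps, from `10.14` within `14`, from `3.17` within `3` (the mover offset `j → i`).  Memo ATLAS-STAR-g89 §2 (P). [this file · kind: proof] -/
theorem leg_envelope (R : ℕ → ℝ) (t₀ T : ℕ) (h0 : ∀ t, 0 ≤ R t)
    (h : ∀ s, s < T → (∀ s', s' ≤ s → 3 / 2 < R (t₀ + s')) →
      R (t₀ + s + 1) ^ 2 ≤ 10067 / 10000 * (R (t₀ + s) ^ 2 - 1412 / 1000 * R (t₀ + s) + 10023 / 10000)) :
    (15 ≤ T → R t₀ ≤ 539 / 50 → ∃ s, s ≤ 15 ∧ R (t₀ + s) ≤ 3 / 2) ∧ (14 ≤ T → R t₀ ≤ 507 / 50 → ∃ s, s ≤ 14 ∧ R (t₀ + s) ≤ 3 / 2) ∧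
    (3 ≤ T → R t₀ ≤ 317 / 100 → ∃ s, s ≤ 3 ∧ R (t₀ + s) ≤ 3 / 2) := by
  have rung : ∀ (b c : ℝ) (k : ℕ), 0 ≤ c → 10067 / 10000 * (b ^ 2 - 1412 / 1000 * b + 10023 / 10000) ≤ c ^ 2 →
      (∀ s, s + k ≤ T → (∀ s', s' < s → 3 / 2 < R (t₀ + s')) → R (t₀ + s) ≤ c → ∃ s'', s'' ≤ k ∧ R (t₀ + s + s'') ≤ 3 / 2) →
      ∀ s, s + (k + 1) ≤ T → (∀ s', s' < s → 3 / 2 < R (t₀ + s')) → R (t₀ + s) ≤ b → ∃ s'', s'' ≤ k + 1 ∧ R (t₀ + s + s'') ≤ 3 / 2 := by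
    intro b c k hc hbc ih s hsT hprev hsb
    rcases le_or_gt (R (t₀ + s)) (3 / 2) with hstop | hgo
    · exact ⟨0, Nat.zero_le _, by simpa using hstop⟩
    · have hall : ∀ s', s' ≤ s → 3 / 2 < R (t₀ + s') := fun s' hs' => (Nat.lt_or_eq_of_le hs').elim (hprev s') (fun e => e ▸ hgo)
      rcases leg_envelope_step (h0 (t₀ + s + 1)) (fun _ => h s (by omega) hall) hsb hc hbc with hs' | hs'
      · exact absurd hs' (not_le.2 hgo)
      · obtain ⟨s'', hk, hR⟩ := ih (s + 1) (by omega) (fun s' hs' => hall s' (by omega)) (by rw [← add_assoc]; exact hs')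
        exact ⟨s'' + 1, by omega, by rw [show t₀ + s + (s'' + 1) = t₀ + (s + 1) + s'' by omega]; exact hR⟩
  have r0 : ∀ s, s + 0 ≤ T → (∀ s', s' < s → 3 / 2 < R (t₀ + s')) → R (t₀ + s) ≤ 3 / 2 → ∃ s'', s'' ≤ 0 ∧ R (t₀ + s + s'') ≤ 3 / 2 :=
    fun s _ _ hs => ⟨0, le_rfl, by simpa using hs⟩
  have r1 := rung (101 / 50) (3 / 2) 0 (by norm_num) (by norm_num) r0
  have r2 := rung (129 / 50) (101 / 50) 1 (by norm_num) (by norm_num) r1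
  have r3 := rung (317 / 100) (129 / 50) 2 (by norm_num) (by norm_num) r2
  have r4 := rung (189 / 50) (317 / 100) 3 (by norm_num) (by norm_num) r3
  have r5 := rung (22 / 5) (189 / 50) 4 (by norm_num) (by norm_num) r4
  have r6 := rung (503 / 100) (22 / 5) 5 (by norm_num) (by norm_num) r5
  have r7 := rung (283 / 50) (503 / 100) 6 (by norm_num) (by norm_num) r6
  have r8 := rung (63 / 10) (283 / 50) 7 (by norm_num) (by norm_num) r7
  have r9 := rung (347 / 50) (63 / 10) 8 (by norm_num) (by norm_num) r8
  have r10 := rung (379 / 50) (347 / 50) 9 (by norm_num) (by norm_num) r9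
  have r11 := rung (411 / 50) (379 / 50) 10 (by norm_num) (by norm_num) r10
  have r12 := rung (443 / 50) (411 / 50) 11 (by norm_num) (by norm_num) r11
  have r13 := rung (19 / 2) (443 / 50) 12 (by norm_num) (by norm_num) r12
  have r14 := rung (507 / 50) (19 / 2) 13 (by norm_num) (by norm_num) r13
  have r15 := rung (539 / 50) (507 / 50) 14 (by norm_num) (by norm_num) r14
  have hnone : ∀ s', s' < 0 → 3 / 2 < R (t₀ + s') := fun s' hs' => absurd hs' (Nat.not_lt_zero _)
  have fin : ∀ {k : ℕ} {b : ℝ}, (∀ s, s + k ≤ T → (∀ s', s' < s → 3 / 2 < R (t₀ + s')) → R (t₀ + s) ≤ b → ∃ s'', s'' ≤ k ∧ R (t₀ + s + s'') ≤ 3 / 2) →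
      k ≤ T → R t₀ ≤ b → ∃ s, s ≤ k ∧ R (t₀ + s) ≤ 3 / 2 := fun hr hT hR0 => by
    obtain ⟨s, hs, hR⟩ := hr 0 (by omega) hnone (by simpa using hR0); exact ⟨s, hs, by simpa using hR⟩
  exact ⟨fin r15, fin r14, fin r3⟩

end Summit.AtomisticToContinuum.Crystallization.Theorems.OverbindingBudgetAffineRunCutLegCover
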